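import Mathlib

/-!
# `SnSubsetDichotomy.PolynomialSlack`, line `transport-split-hull` — shape of product-free hulls

A kernel-checked remark on the open stub `stub_hull` (crux `stmt-MatrixMultiplication-8306`, line
`transport-split-hull`): the "junta form" of the product-free hull statement — every poly-dense
exactly product-free triple of `S_n` is `4/5`-captured by an exactly product-free triple of sets
definable from `O(1)` coordinates — is FALSE, so any capturing hull family must contain members whose
first set contains no cylinder of small codimension (Kedlaya-type "set-system" configurations).

The obstruction.  Fix a base point `p : Fin n` and `I ⊆ Fin n`, and let
`Y_I = {τ : τ p ∈ I}` (a disjoint union of the `|I|` fibres `U_{p→i} = {τ : τ p = i}`, all of the same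
size).  Suppose `(H₁, H₂, H₃)` is exactly product-free (`x * y ∉ H₃` for `x ∈ H₁`, `y ∈ H₂`) and
`H₂`, `H₃` each contain `4/5` of `Y_I`.  By Markov, `H₂` fills more than half of the fibre `U_{p→i}`
for at least `3/5` of the `i ∈ I` (`card_popular_ge`), and likewise `H₃`.  If `σ ∈ H₁` maps such a
popular `i` for `H₂` to a popular value `σ i` for `H₃`, then `σ · (H₂ ∩ U_{p→i}) ⊆ U_{p→σ i}` and
`H₃ ∩ U_{p→σ i}` are two subsets of one fibre, each of more than half its size, so they meet:
`σ * τ ∈ H₃` for some `τ ∈ H₂` — contradiction (`not_popular_to_popular`).  Hence every `σ ∈ H₁`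
maps the `H₂`-popular part of `I` away from the `H₃`-popular part.  But a CYLINDER
`{σ : σ j = σ₀ j ∀ j ∈ J}` with `5|J| < 3|I|` always contains a permutation sending some popular
`i₀ ∉ J` to some popular value outside `σ₀(J)` (`swap (σ₀ i₀) p₀ * σ₀`), so `H₁` contains no such
cylinder (`no_small_cylinder_in_productFree_hull`).  Since the Kedlaya triple
`X_I = {σ : σ(I) ∩ I = ∅}`, `Y_I`, `Y_I` (with `p ∉ I`) IS exactly product-free
(`kedlaya_triple_productFree`) and, for `|I| ≍ √n`, has densities `≈ e^{-1}, n^{-1/2}, n^{-1/2}`, the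
first set of any hull capturing it is cylinder-free below codimension `0.6|I| ≍ √n`: hull families for
`stub_hull` cannot consist of bounded-level junta triples.  (This does not refute `stub_hull`: the
Kedlaya configurations themselves are hulls with `O(n)`-bit descriptions.)

References: K. S. Kedlaya, *Large product-free subsets of finite groups*, JCTA 77 (1997), and
Keevash–Lifshitz–Minzer, arXiv:2205.15191 (the extremal product-free families in `A_n`), for the
configuration; the capture obstruction is this line's.
-/

namespace Summit.MatrixMultiplication.MatrixMultiplication.Theorems.PolynomialSlack

open Finset

set_option linter.dupNamespace false

-- Throughout, the fibre `U_{p→i} = {τ : τ p = i}` is written `Finset.univ.filter (fun τ => τ p = i)`.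

/-- All fibres `U_{p→i}` over a fixed base point have the same size (left multiplication by
`swap i j` is a bijection `U_{p→i} → U_{p→j}`). [folklore] -/
theorem card_fibre_eq {n : ℕ} (p i j : Fin n) : ((Finset.univ.filter fun τ : Equiv.Perm (Fin n) => τ p = i)).card = ((Finset.univ.filter fun τ : Equiv.Perm (Fin n) => τ p = j)).card := by
  refine Finset.card_bij (fun τ _ => Equiv.swap i j * τ) ?_ ?_ ?_
  · intro τ hτ
    simp only [Finset.mem_filter, Finset.mem_univ, true_and] at hτ ⊢
    rw [Equiv.Perm.mul_apply, hτ, Equiv.swap_apply_left]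
  · intro τ₁ _ τ₂ _ h
    exact mul_left_cancel h
  · intro τ hτ
    simp only [Finset.mem_filter, Finset.mem_univ, true_and] at hτ
    refine ⟨Equiv.swap i j * τ, ?_, ?_⟩
    · simp only [Finset.mem_filter, Finset.mem_univ, true_and]
      rw [Equiv.Perm.mul_apply, hτ, Equiv.swap_apply_right]
    · rw [← mul_assoc, Equiv.swap_mul_self, one_mul]

/-- Left multiplication by `σ` maps the fibre over `i` into the fibre over `σ i`. [folklore] -/
theorem mul_mem_fibre {n : ℕ} {p i : Fin n} (σ : Equiv.Perm (Fin n)) {τ : Equiv.Perm (Fin n)}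
    (hτ : τ ∈ (Finset.univ.filter fun τ : Equiv.Perm (Fin n) => τ p = i)) : σ * τ ∈ (Finset.univ.filter fun τ : Equiv.Perm (Fin n) => τ p = σ i) := by
  simp only [Finset.mem_filter, Finset.mem_univ, true_and] at hτ ⊢
  rw [Equiv.Perm.mul_apply, hτ]

/-- **Popular-to-popular is forbidden.**  If `(H₁?, H₂, H₃)`-style exactness `σ * τ ∉ H₃` holds for
all `τ ∈ H₂`, then `σ` cannot map a point `i` whose fibre is more than half inside `H₂` to a point
whose fibre is more than half inside `H₃` (two majority subsets of the fibre `U_{p→σ i}` meet).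
[folklore] -/
theorem not_popular_to_popular {n : ℕ} (p i : Fin n) (σ : Equiv.Perm (Fin n))
    (H₂ H₃ : Finset (Equiv.Perm (Fin n))) (hσ : ∀ τ ∈ H₂, σ * τ ∉ H₃)
    (hi : ((Finset.univ.filter fun τ : Equiv.Perm (Fin n) => τ p = i)).card < 2 * ((Finset.univ.filter fun τ : Equiv.Perm (Fin n) => τ p = i) ∩ H₂).card)
    (hσi : ((Finset.univ.filter fun τ : Equiv.Perm (Fin n) => τ p = σ i)).card < 2 * ((Finset.univ.filter fun τ : Equiv.Perm (Fin n) => τ p = σ i) ∩ H₃).card) : False := by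
  -- the translate `σ · (U_{p→i} ∩ H₂)` and `U_{p→σ i} ∩ H₃` are disjoint subsets of `U_{p→σ i}`
  set A : Finset (Equiv.Perm (Fin n)) := ((Finset.univ.filter fun τ : Equiv.Perm (Fin n) => τ p = i) ∩ H₂).image (σ * ·) with hA
  have hAcard : A.card = ((Finset.univ.filter fun τ : Equiv.Perm (Fin n) => τ p = i) ∩ H₂).card :=
    Finset.card_image_of_injective _ (mul_right_injective σ)
  have hAsub : A ⊆ (Finset.univ.filter fun τ : Equiv.Perm (Fin n) => τ p = σ i) := by
    intro x hx
    rw [hA, Finset.mem_image] at hx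
    obtain ⟨τ, hτ, rfl⟩ := hx
    exact mul_mem_fibre σ (Finset.mem_of_mem_inter_left hτ)
  have hdisj : Disjoint A ((Finset.univ.filter fun τ : Equiv.Perm (Fin n) => τ p = σ i) ∩ H₃) := by
    rw [Finset.disjoint_left]
    intro x hx hx'
    rw [hA, Finset.mem_image] at hx
    obtain ⟨τ, hτ, rfl⟩ := hx
    exact hσ τ (Finset.mem_of_mem_inter_right hτ) (Finset.mem_of_mem_inter_right hx')
  have hunion : (A ∪ ((Finset.univ.filter fun τ : Equiv.Perm (Fin n) => τ p = σ i) ∩ H₃)).card ≤ ((Finset.univ.filter fun τ : Equiv.Perm (Fin n) => τ p = σ i)).card :=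
    Finset.card_le_card (Finset.union_subset hAsub Finset.inter_subset_left)
  rw [Finset.card_union_of_disjoint hdisj, hAcard] at hunion
  have heq := card_fibre_eq p i (σ i)
  omega

/-- **Markov step.**  If `H` contains at least `4/5` of `Y_I = ⊔_{i ∈ I} U_{p→i}`, then the set of
`i ∈ I` whose fibre is more than half inside `H` has at least `3/5` of the elements of `I`.
[folklore] -/
theorem card_popular_ge {n : ℕ} (p : Fin n) (I : Finset (Fin n)) (H : Finset (Equiv.Perm (Fin n)))
    (hH : 4 * (Finset.univ.filter fun τ : Equiv.Perm (Fin n) => τ p ∈ I).card ≤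
      5 * ((Finset.univ.filter fun τ : Equiv.Perm (Fin n) => τ p ∈ I) ∩ H).card) :
    3 * I.card ≤ 5 * (I.filter fun i => ((Finset.univ.filter fun τ : Equiv.Perm (Fin n) => τ p = i)).card < 2 * ((Finset.univ.filter fun τ : Equiv.Perm (Fin n) => τ p = i) ∩ H).card).card := by
  -- common fibre size `u`
  rcases I.eq_empty_or_nonempty with rfl | ⟨i₀, hi₀⟩
  · simp
  set u : ℕ := ((Finset.univ.filter fun τ : Equiv.Perm (Fin n) => τ p = i₀)).card with hu
  have hfu : ∀ i, ((Finset.univ.filter fun τ : Equiv.Perm (Fin n) => τ p = i)).card = u := fun i => card_fibre_eq p i i₀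
  -- `Y_I` and `Y_I ∩ H` fibre by fibre
  have hY : (Finset.univ.filter fun τ : Equiv.Perm (Fin n) => τ p ∈ I) =
      I.biUnion (fun i => (Finset.univ.filter fun τ : Equiv.Perm (Fin n) => τ p = i)) := by
    ext τ
    simp only [Finset.mem_filter, Finset.mem_univ, true_and, Finset.mem_biUnion]
    constructor
    · intro h; exact ⟨τ p, h, rfl⟩
    · rintro ⟨i, hi, h⟩; rw [h]; exact hi
  have hdisjf : Set.PairwiseDisjoint (↑I : Set (Fin n)) (fun i => (Finset.univ.filter fun τ : Equiv.Perm (Fin n) => τ p = i)) := by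
    intro i _ j _ hij
    rw [Function.onFun, Finset.disjoint_left]
    intro τ hτi hτj
    simp only [Finset.mem_filter, Finset.mem_univ, true_and] at hτi hτj
    exact hij (hτi.symm.trans hτj)
  have hYcard : (Finset.univ.filter fun τ : Equiv.Perm (Fin n) => τ p ∈ I).card = I.card * u := by
    rw [hY, Finset.card_biUnion hdisjf, Finset.sum_congr rfl (fun i _ => hfu i), Finset.sum_const,
      smul_eq_mul]
  have hYH : ((Finset.univ.filter fun τ : Equiv.Perm (Fin n) => τ p ∈ I) ∩ H).card =
      ∑ i ∈ I, ((Finset.univ.filter fun τ : Equiv.Perm (Fin n) => τ p = i) ∩ H).card := by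
    rw [hY, Finset.biUnion_inter, Finset.card_biUnion]
    intro i hi j hj hij
    exact Finset.disjoint_of_subset_left Finset.inter_subset_left
      (Finset.disjoint_of_subset_right Finset.inter_subset_left (hdisjf hi hj hij))
  rw [hYcard, hYH] at hH
  -- fibrewise: `2|U_i ∩ H| ≤ u + [i popular]·u`
  have hle : ∀ i ∈ I, 2 * ((Finset.univ.filter fun τ : Equiv.Perm (Fin n) => τ p = i) ∩ H).card ≤
      u + (if ((Finset.univ.filter fun τ : Equiv.Perm (Fin n) => τ p = i)).card < 2 * ((Finset.univ.filter fun τ : Equiv.Perm (Fin n) => τ p = i) ∩ H).card then u else 0) := by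
    intro i _
    have hsub : ((Finset.univ.filter fun τ : Equiv.Perm (Fin n) => τ p = i) ∩ H).card ≤ u := by
      rw [← hfu i]; exact Finset.card_le_card Finset.inter_subset_left
    split_ifs with h
    · omega
    · rw [hfu i] at h; omega
  have hsum : 2 * ∑ i ∈ I, ((Finset.univ.filter fun τ : Equiv.Perm (Fin n) => τ p = i) ∩ H).card ≤ I.card * u +
      (I.filter fun i => ((Finset.univ.filter fun τ : Equiv.Perm (Fin n) => τ p = i)).card < 2 * ((Finset.univ.filter fun τ : Equiv.Perm (Fin n) => τ p = i) ∩ H).card).card * u := by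
    calc 2 * ∑ i ∈ I, ((Finset.univ.filter fun τ : Equiv.Perm (Fin n) => τ p = i) ∩ H).card = ∑ i ∈ I, 2 * ((Finset.univ.filter fun τ : Equiv.Perm (Fin n) => τ p = i) ∩ H).card :=
          Finset.mul_sum _ _ _
      _ ≤ ∑ i ∈ I, (u + (if ((Finset.univ.filter fun τ : Equiv.Perm (Fin n) => τ p = i)).card < 2 * ((Finset.univ.filter fun τ : Equiv.Perm (Fin n) => τ p = i) ∩ H).card then u else 0)) :=
          Finset.sum_le_sum hle
      _ = I.card * u +
          (I.filter fun i => ((Finset.univ.filter fun τ : Equiv.Perm (Fin n) => τ p = i)).card < 2 * ((Finset.univ.filter fun τ : Equiv.Perm (Fin n) => τ p = i) ∩ H).card).card * u := by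
          rw [Finset.sum_add_distrib, Finset.sum_const, smul_eq_mul, Finset.sum_ite,
            Finset.sum_const_zero, add_zero, Finset.sum_const, smul_eq_mul]
  -- `8|I|u ≤ 10 Σ ≤ 5|I|u + 5|P|u`, whence `3|I| ≤ 5|P|` (as `u > 0`)
  have hu0 : 0 < u := by
    rw [hu]
    exact Finset.card_pos.2 ⟨Equiv.swap p i₀, by simp [Equiv.swap_apply_left]⟩
  have key : 3 * I.card * u ≤
      5 * (I.filter fun i => ((Finset.univ.filter fun τ : Equiv.Perm (Fin n) => τ p = i)).card < 2 * ((Finset.univ.filter fun τ : Equiv.Perm (Fin n) => τ p = i) ∩ H).card).card * u := by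
    linarith
  exact Nat.le_of_mul_le_mul_right key hu0

/-- **A small cylinder reaches every popular pair.**  If `i₀ ∉ J` and `p₀ ∉ σ₀(J)`, the cylinder
`{σ : σ j = σ₀ j ∀ j ∈ J}` contains a permutation with `σ i₀ = p₀`, namely `swap (σ₀ i₀) p₀ * σ₀`.
[folklore] -/
theorem exists_mem_cylinder_apply_eq {n : ℕ} (J : Finset (Fin n)) (σ₀ : Equiv.Perm (Fin n))
    (i₀ p₀ : Fin n) (hi₀ : i₀ ∉ J) (hp₀ : ∀ j ∈ J, σ₀ j ≠ p₀) :
    ∃ σ : Equiv.Perm (Fin n), (∀ j ∈ J, σ j = σ₀ j) ∧ σ i₀ = p₀ := by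
  refine ⟨Equiv.swap (σ₀ i₀) p₀ * σ₀, fun j hj => ?_, ?_⟩
  · rw [Equiv.Perm.mul_apply]
    refine Equiv.swap_apply_of_ne_of_ne ?_ (hp₀ j hj)
    intro h
    exact hi₀ (by rwa [← σ₀.injective h])
  · rw [Equiv.Perm.mul_apply, Equiv.swap_apply_left]

/-- **No small cylinder in a capturing hull (the junta form of `stub_hull` is false).**  Let
`(H₁, H₂, H₃)` be exactly product-free and let `H₂`, `H₃` each contain at least `4/5` of
`Y_I = {τ : τ p ∈ I}`.  Then `H₁` contains no cylinder `{σ : σ j = σ₀ j ∀ j ∈ J}` of codimension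
`|J| < 3|I|/5`.  (Apply to the Kedlaya triple `(X_I, Y_I, Y_I)`, `|I| ≍ √n`, which is exactly
product-free by `kedlaya_triple_productFree` and poly-dense: a `4/5`-capturing hull for it has a
first set free of cylinders of codimension `< 0.6√n`, so hull families made of bounded-level junta
triples cannot satisfy `stub_hull`.) [folklore] -/
theorem no_small_cylinder_in_productFree_hull {n : ℕ} (p : Fin n) (I J : Finset (Fin n))
    (σ₀ : Equiv.Perm (Fin n)) (H₁ H₂ H₃ : Finset (Equiv.Perm (Fin n)))
    (hpf : ∀ x ∈ H₁, ∀ y ∈ H₂, x * y ∉ H₃)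
    (hH₂ : 4 * (Finset.univ.filter fun τ : Equiv.Perm (Fin n) => τ p ∈ I).card ≤
      5 * ((Finset.univ.filter fun τ : Equiv.Perm (Fin n) => τ p ∈ I) ∩ H₂).card)
    (hH₃ : 4 * (Finset.univ.filter fun τ : Equiv.Perm (Fin n) => τ p ∈ I).card ≤
      5 * ((Finset.univ.filter fun τ : Equiv.Perm (Fin n) => τ p ∈ I) ∩ H₃).card)
    (hJ : 5 * J.card < 3 * I.card)
    (hcyl : ∀ σ : Equiv.Perm (Fin n), (∀ j ∈ J, σ j = σ₀ j) → σ ∈ H₁) : False := by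
  -- popular points for `H₂` and popular values for `H₃`
  set Pa := I.filter fun i => ((Finset.univ.filter fun τ : Equiv.Perm (Fin n) => τ p = i)).card < 2 * ((Finset.univ.filter fun τ : Equiv.Perm (Fin n) => τ p = i) ∩ H₂).card with hPa
  set Pb := I.filter fun i => ((Finset.univ.filter fun τ : Equiv.Perm (Fin n) => τ p = i)).card < 2 * ((Finset.univ.filter fun τ : Equiv.Perm (Fin n) => τ p = i) ∩ H₃).card with hPb
  have ha : 3 * I.card ≤ 5 * Pa.card := card_popular_ge p I H₂ hH₂
  have hb : 3 * I.card ≤ 5 * Pb.card := card_popular_ge p I H₃ hH₃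
  -- a popular point outside `J` and a popular value outside `σ₀(J)`
  have hPaJ : J.card < Pa.card := by omega
  have hPbJ : (J.image σ₀).card < Pb.card := lt_of_le_of_lt Finset.card_image_le (by omega)
  obtain ⟨i₀, hi₀Pa, hi₀J⟩ : ∃ i₀, i₀ ∈ Pa ∧ i₀ ∉ J :=
    Finset.exists_mem_notMem_of_card_lt_card hPaJ
  obtain ⟨p₀, hp₀Pb, hp₀J⟩ : ∃ p₀, p₀ ∈ Pb ∧ p₀ ∉ J.image σ₀ :=
    Finset.exists_mem_notMem_of_card_lt_card hPbJ
  have hp₀' : ∀ j ∈ J, σ₀ j ≠ p₀ := by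
    intro j hj h
    exact hp₀J (Finset.mem_image.2 ⟨j, hj, h⟩)
  obtain ⟨σ, hσJ, hσi₀⟩ := exists_mem_cylinder_apply_eq J σ₀ i₀ p₀ hi₀J hp₀'
  have hσH₁ : σ ∈ H₁ := hcyl σ hσJ
  rw [hPa, Finset.mem_filter] at hi₀Pa
  rw [hPb, Finset.mem_filter] at hp₀Pb
  refine not_popular_to_popular p i₀ σ H₂ H₃ (hpf σ hσH₁) hi₀Pa.2 ?_
  rw [hσi₀]
  exact hp₀Pb.2

/-- **The Kedlaya triple is exactly product-free.**  For `p ∉ I`... (no hypothesis on `p` is even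
needed): with `X_I = {σ : σ i ∉ I ∀ i ∈ I}` and `Y_I = {τ : τ p ∈ I}`, every product `σ * τ`,
`σ ∈ X_I`, `τ ∈ Y_I`, has `(σ * τ) p = σ (τ p) ∉ I`, so `X_I · Y_I ∩ Y_I = ∅`
(Kedlaya 1997; the extremal product-free family of Keevash–Lifshitz–Minzer). [folklore] -/
theorem kedlaya_triple_productFree {n : ℕ} (p : Fin n) (I : Finset (Fin n)) :
    ∀ x ∈ (Finset.univ.filter fun σ : Equiv.Perm (Fin n) => ∀ i ∈ I, σ i ∉ I),
      ∀ y ∈ (Finset.univ.filter fun τ : Equiv.Perm (Fin n) => τ p ∈ I),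
        x * y ∉ (Finset.univ.filter fun τ : Equiv.Perm (Fin n) => τ p ∈ I) := by
  intro x hx y hy hxy
  simp only [Finset.mem_filter, Finset.mem_univ, true_and] at hx hy hxy
  rw [Equiv.Perm.mul_apply] at hxy
  exact hx (y p) hy hxy

/-- **Corollary — no family of "junta hulls" captures the Kedlaya triple.**  If every member `H` of a
family `𝓗` of exactly product-free triples has a first set containing a cylinder
`{σ : σ j = σ₀ j ∀ j ∈ J}` of codimension `|J| < 3|I|/5` (e.g. `H.1` is a non-empty union of
level-`t` cylinders, `5t < 3|I|`), then NO member of `𝓗` `4/5`-captures a triple whose second and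
third sets are `Y_I = {τ : τ p ∈ I}` — whatever the first set `X` is (for the Kedlaya triple take
`X = X_I`, exactly product-free against `(Y_I, Y_I)` by `kedlaya_triple_productFree`).  This is the
precise sense in which the junta form of `stub_hull` fails. [folklore] -/
theorem no_junta_hull_captures {n : ℕ} (p : Fin n) (I : Finset (Fin n))
    (X : Finset (Equiv.Perm (Fin n)))
    (𝓗 : Finset (Finset (Equiv.Perm (Fin n)) × Finset (Equiv.Perm (Fin n)) ×
      Finset (Equiv.Perm (Fin n))))
    (hpf : ∀ H ∈ 𝓗, ∀ x ∈ H.1, ∀ y ∈ H.2.1, x * y ∉ H.2.2)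
    (hjunta : ∀ H ∈ 𝓗, ∃ (J : Finset (Fin n)) (σ₀ : Equiv.Perm (Fin n)), 5 * J.card < 3 * I.card ∧
      ∀ σ : Equiv.Perm (Fin n), (∀ j ∈ J, σ j = σ₀ j) → σ ∈ H.1) :
    ¬ ∃ H ∈ 𝓗, 4 * X.card ≤ 5 * (X ∩ H.1).card ∧
        4 * (Finset.univ.filter fun τ : Equiv.Perm (Fin n) => τ p ∈ I).card ≤
          5 * ((Finset.univ.filter fun τ : Equiv.Perm (Fin n) => τ p ∈ I) ∩ H.2.1).card ∧
        4 * (Finset.univ.filter fun τ : Equiv.Perm (Fin n) => τ p ∈ I).card ≤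
          5 * ((Finset.univ.filter fun τ : Equiv.Perm (Fin n) => τ p ∈ I) ∩ H.2.2).card := by
  rintro ⟨H, hH, -, hY₂, hY₃⟩
  obtain ⟨J, σ₀, hJ, hcyl⟩ := hjunta H hH
  exact no_small_cylinder_in_productFree_hull p I J σ₀ H.1 H.2.1 H.2.2 (hpf H hH) hY₂ hY₃ hJ hcyl

/-! ### The Kedlaya triple is poly-dense (so it lies in `stub_hull`'s hypothesis range) -/

/-- Fibre sizes do not depend on the base point either: right multiplication by `swap i p` is a
bijection `{σ : σ p = j} → {σ : σ i = j}`. [folklore] -/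
theorem card_fibre_eq_base {n : ℕ} (p i j : Fin n) :
    ((Finset.univ.filter fun τ : Equiv.Perm (Fin n) => τ p = j)).card =
      ((Finset.univ.filter fun τ : Equiv.Perm (Fin n) => τ i = j)).card := by
  refine Finset.card_bij (fun τ _ => τ * Equiv.swap i p) ?_ ?_ ?_
  · intro τ hτ
    simp only [Finset.mem_filter, Finset.mem_univ, true_and] at hτ ⊢
    rw [Equiv.Perm.mul_apply, Equiv.swap_apply_left, hτ]
  · intro τ₁ _ τ₂ _ h
    exact mul_right_cancel h
  · intro τ hτ
    simp only [Finset.mem_filter, Finset.mem_univ, true_and] at hτ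
    refine ⟨τ * Equiv.swap i p, ?_, ?_⟩
    · simp only [Finset.mem_filter, Finset.mem_univ, true_and]
      rw [Equiv.Perm.mul_apply, Equiv.swap_apply_right, hτ]
    · rw [mul_assoc, Equiv.swap_mul_self, mul_one]

/-- The fibres over a base point partition `S_n`: `n · |U_{p→j}| = n!` for every `j`. [folklore] -/
theorem card_mul_card_fibre {n : ℕ} (p j : Fin n) :
    n * ((Finset.univ.filter fun τ : Equiv.Perm (Fin n) => τ p = j)).card = n.factorial := by
  have hunion : (Finset.univ : Finset (Equiv.Perm (Fin n))) =
      (Finset.univ : Finset (Fin n)).biUnion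
        (fun i => Finset.univ.filter fun τ : Equiv.Perm (Fin n) => τ p = i) := by
    ext τ
    simp only [Finset.mem_univ, Finset.mem_biUnion, Finset.mem_filter, true_and, true_iff]
    exact ⟨τ p, rfl⟩
  have hdisj : Set.PairwiseDisjoint (↑(Finset.univ : Finset (Fin n)) : Set (Fin n))
      (fun i => Finset.univ.filter fun τ : Equiv.Perm (Fin n) => τ p = i) := by
    intro i _ i' _ hii'
    rw [Function.onFun, Finset.disjoint_left]
    intro τ hτ hτ'
    simp only [Finset.mem_filter, Finset.mem_univ, true_and] at hτ hτ'
    exact hii' (hτ.symm.trans hτ')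
  have hcard := congrArg Finset.card hunion
  rw [Finset.card_univ, Fintype.card_perm, Fintype.card_fin, Finset.card_biUnion hdisj,
    Finset.sum_congr rfl (fun i _ => card_fibre_eq p i j), Finset.sum_const, Finset.card_univ,
    Fintype.card_fin, smul_eq_mul] at hcard
  exact hcard.symm

/-- `n · |{τ : τ p ∈ I}| = |I| · n!` — the set `Y_I` has density exactly `|I|/n`. [folklore] -/
theorem card_mul_card_filter_apply_mem {n : ℕ} (p : Fin n) (I : Finset (Fin n)) :
    n * (Finset.univ.filter fun τ : Equiv.Perm (Fin n) => τ p ∈ I).card = I.card * n.factorial := by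
  have hY : (Finset.univ.filter fun τ : Equiv.Perm (Fin n) => τ p ∈ I) =
      I.biUnion (fun i => Finset.univ.filter fun τ : Equiv.Perm (Fin n) => τ p = i) := by
    ext τ
    simp only [Finset.mem_filter, Finset.mem_univ, true_and, Finset.mem_biUnion]
    constructor
    · intro h; exact ⟨τ p, h, rfl⟩
    · rintro ⟨i, hi, h⟩; rw [h]; exact hi
  have hdisj : Set.PairwiseDisjoint (↑I : Set (Fin n))
      (fun i => Finset.univ.filter fun τ : Equiv.Perm (Fin n) => τ p = i) := by
    intro i _ i' _ hii'
    rw [Function.onFun, Finset.disjoint_left]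
    intro τ hτ hτ'
    simp only [Finset.mem_filter, Finset.mem_univ, true_and] at hτ hτ'
    exact hii' (hτ.symm.trans hτ')
  rcases I.eq_empty_or_nonempty with rfl | ⟨i₀, hi₀⟩
  · simp
  rw [hY, Finset.card_biUnion hdisj, Finset.sum_congr rfl (fun i _ => card_fibre_eq p i i₀),
    Finset.sum_const, smul_eq_mul, ← mul_assoc, mul_comm n, mul_assoc, card_mul_card_fibre p i₀]

/-- **Density of the Kedlaya set.**  `n · |{σ : σ(I) ∩ I = ∅}| ≥ (n − |I|²) · n!` (union bound: the
complement is covered by the `|I|` sets `{σ : σ i ∈ I}`, `i ∈ I`, each of size `|I| · n!/n`); in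
particular `2 · |X_I| ≥ n!` as soon as `2|I|² ≤ n`, and `n · |Y_I| = |I| · n! ≥ n!` for `I ≠ ∅`
(`card_mul_card_filter_apply_mem`): for `n ≥ 2` the Kedlaya triple `(X_I, Y_I, Y_I)` satisfies the
density hypotheses `n! ≤ |·| · n^C` of `stub_hull` for every `C ≥ 1`. [folklore] -/
theorem kedlaya_set_dense {n : ℕ} (I : Finset (Fin n)) :
    (n - I.card ^ 2) * n.factorial ≤
      n * (Finset.univ.filter fun σ : Equiv.Perm (Fin n) => ∀ i ∈ I, σ i ∉ I).card := by
  classical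
  set X := Finset.univ.filter fun σ : Equiv.Perm (Fin n) => ∀ i ∈ I, σ i ∉ I with hX
  -- the complement of `X` inside `S_n` is covered by the sets `{σ : σ i ∈ I}`, `i ∈ I`
  have hcompl : Finset.univ \ X ⊆
      I.biUnion (fun i => Finset.univ.filter fun σ : Equiv.Perm (Fin n) => σ i ∈ I) := by
    intro σ hσ
    have hσX : σ ∉ X := (Finset.mem_sdiff.1 hσ).2
    have h : ¬ ∀ i ∈ I, σ i ∉ I := fun hall =>
      hσX (by rw [hX]; exact Finset.mem_filter.2 ⟨Finset.mem_univ _, hall⟩)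
    simp only [not_forall, not_not] at h
    obtain ⟨i, hi, hσi⟩ := h
    exact Finset.mem_biUnion.2 ⟨i, hi, Finset.mem_filter.2 ⟨Finset.mem_univ _, hσi⟩⟩
  have hcover : n * (Finset.univ \ X).card ≤ I.card ^ 2 * n.factorial := by
    calc n * (Finset.univ \ X).card
        ≤ n * (I.biUnion (fun i => Finset.univ.filter fun σ : Equiv.Perm (Fin n) => σ i ∈ I)).card :=
          Nat.mul_le_mul_left _ (Finset.card_le_card hcompl)
      _ ≤ n * ∑ i ∈ I, (Finset.univ.filter fun σ : Equiv.Perm (Fin n) => σ i ∈ I).card :=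
          Nat.mul_le_mul_left _ Finset.card_biUnion_le
      _ = ∑ i ∈ I, n * (Finset.univ.filter fun σ : Equiv.Perm (Fin n) => σ i ∈ I).card :=
          Finset.mul_sum _ _ _
      _ = ∑ i ∈ I, I.card * n.factorial :=
          Finset.sum_congr rfl (fun i _ => card_mul_card_filter_apply_mem i I)
      _ = I.card ^ 2 * n.factorial := by rw [Finset.sum_const, smul_eq_mul]; ring
  have hsplit : (Finset.univ \ X).card + X.card = n.factorial := by
    rw [Finset.card_sdiff_add_card_eq_card (Finset.subset_univ X), Finset.card_univ,
      Fintype.card_perm, Fintype.card_fin]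
  -- `n·n! = n·|Xᶜ| + n·|X| ≤ |I|²·n! + n·|X|`
  have h1 : n * n.factorial ≤ I.card ^ 2 * n.factorial + n * X.card := by
    calc n * n.factorial = n * ((Finset.univ \ X).card + X.card) := by rw [hsplit]
      _ = n * (Finset.univ \ X).card + n * X.card := by ring
      _ ≤ I.card ^ 2 * n.factorial + n * X.card := Nat.add_le_add_right hcover _
  calc (n - I.card ^ 2) * n.factorial = n * n.factorial - I.card ^ 2 * n.factorial :=
        Nat.sub_mul _ _ _
    _ ≤ n * X.card := by omega

end Summit.MatrixMultiplication.MatrixMultiplication.Theorems.PolynomialSlack
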